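import Summits.ResolutionOfSingularities.ResolutionOfSingularities.Theorems.RadicialJungCleanModelsT2Giraud24OverField
import Summits.ResolutionOfSingularities.ResolutionOfSingularities.Theorems.RadicialJungCleanModelsDimTwoCleanOverField
import Summits.ResolutionOfSingularities.ResolutionOfSingularities.Theorems.RadicialJungCleanModelsReduction
import HarnessLib

/-!
# Route `RadicialJung`, crux `CleanModels` (stmt-15917): clean models in dimension `≤ 2` over an
# arbitrary field of characteristic `p`, modulo F-75c

Support file (OURS) for PROGRAMME-clean-dim2 / T2, line `via-clean-models` of the crux
`DescentPerfectToAll` (stmt-0549). Nothing here is a statement of Hironaka's manuscript.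

The conclusion of `stub_cleanModels` (stmt-15917) for every regular integral separated `W` of finite
type over a field `k` of characteristic `p` with `dim W ≤ 2`, conditional only on the typed published
fact F-75c (`Stacks0BIC_embeddedResolutionCurvesInSurfaces_locus`, embedded resolution of curves in
regular surfaces): dimension `≤ 1` is `cleanModels_dim_le_one` (`…CleanModelsReduction.lean`),
dimension `2` is `cleanModels_dimTwo_of_giraud24OverField` (res-L0-w81-pv-2,
`…DimTwoCleanOverField.lean`) fed with `T2.giraud24OverField_of_f75c` (res-D-pv-030's assembly of
the T2 programme, `…T2Giraud24OverField.lean`: Giraud's Théorème 2.4 over an arbitrary field).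

* `cleanModels_dimLETwo_of_f75c` — **`CleanModels` for `dim W ≤ 2` modulo F-75c**.

References: J. Giraud, Bull. SMF 111 (1983), Thm. 2.4 [Giraud1983]; Stacks Project Tag 0BIC.
-/

noncomputable section

set_option linter.dupNamespace false -- mandated namespace of this single-conjunct summit

open CategoryTheory AlgebraicGeometry TopologicalSpace IsLocalRing
open Literature.AlgebraicGeometry.Resolution Literature.AlgebraicGeometry.Motives

namespace Summit.ResolutionOfSingularities.ResolutionOfSingularities.Theorems.RadicialJung.CleanModels

/-- **Clean models in dimension `≤ 2` over an arbitrary field of characteristic `p`, modulo F-75c**: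
the conclusion of `stub_cleanModels` for `W` regular, integral, separated of finite type over `k`
with `dim W ≤ 2` and `L/K(W)` purely inseparable of degree `p` — `W` itself in dimension `≤ 1`,
Giraud's Théorème 2.4 (T2 programme) in dimension `2`.
[cite: Giraud1983, Thm. 2.4] [cite: StacksProject, Tag 0BIC] -/
theorem cleanModels_dimLETwo_of_f75c (h75c : Stacks0BIC_embeddedResolutionCurvesInSurfaces_locus.{0})
    (p : ℕ) (hp : p.Prime) (k : Type) [Field k] [CharP k p] (W : Scheme.{0}) [IsIntegral W]
    (f : W ⟶ Spec (.of k)) [IsSeparated f] [LocallyOfFiniteType f] [QuasiCompact f]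
    (hW : Scheme.IsRegular W) (L : Type) [Field L] [Algebra W.functionField L]
    [IsPurelyInseparable W.functionField L] (hdeg : Module.finrank W.functionField L = p)
    (hdim : topologicalKrullDim W ≤ 2) :
    ∃ (V : Scheme.{0}) (π : V ⟶ W) (_ : IsIntegral V) (_ : IsDominant π),
      IsProper π ∧ IsBirational π ∧ Scheme.IsRegular V ∧
      (∀ v : V, (∃ (y : L) (g : W.functionField), y ∉ Set.range (algebraMap W.functionField L) ∧
        algebraMap W.functionField L g = y ^ p ∧
        ((∃ (d m : ℕ) (hmd : m ≤ d) (t : Fin d → V.presheaf.stalk v) (a : Fin m → ℕ),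
            Ideal.span (Set.range t) = maximalIdeal (V.presheaf.stalk v) ∧
            ringKrullDim (V.presheaf.stalk v) = (d : WithBot ℕ∞) ∧ 0 < m ∧ (∀ i, ¬ p ∣ a i) ∧
            RatFn.functionFieldMap π g = ∏ i : Fin m,
              (algebraMap (V.presheaf.stalk v) V.functionField (t (Fin.castLE hmd i))) ^ (a i)) ∨
          (∃ u₀ : V.presheaf.stalk v, IsUnit u₀ ∧
            RatFn.functionFieldMap π g = algebraMap (V.presheaf.stalk v) V.functionField u₀ ∧
            ((∀ c : V.presheaf.stalk v, u₀ - c ^ p ∉ maximalIdeal (V.presheaf.stalk v)) ∨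
              (∃ c : V.presheaf.stalk v, u₀ - c ^ p ∈ maximalIdeal (V.presheaf.stalk v) ∧
                u₀ - c ^ p ∉ maximalIdeal (V.presheaf.stalk v) ^ 2)))))) := by
  by_cases h1 : topologicalKrullDim W ≤ 1
  · exact cleanModels_dim_le_one p hp k W f L inferInstance inferInstance inferInstance hW
      inferInstance hdeg h1
  · obtain ⟨V, π, hV, hdom, hprop, hbir, hreg, -, hpt⟩ :=
      cleanModels_dimTwo_of_giraud24OverField (T2.giraud24OverField_of_f75c h75c) p hp k W f hW L
        hdeg h1 hdim
    exact ⟨V, π, hV, hdom, hprop, hbir, hreg, hpt⟩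

end Summit.ResolutionOfSingularities.ResolutionOfSingularities.Theorems.RadicialJung.CleanModels

end
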